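import Summits.HodgeConjecture.HodgeCM.PerL34.Ball_1

/-! PORT of `HodgeCM/PerL34/Ball.lean` (HodgeCMPerL run 82) — part 2: continuation of `Summits.HodgeConjecture.HodgeCM.PerL34.Ball_1` (split at a top-level declaration boundary by port_pkg.py; scope re-opened below; declarations unchanged). -/

-- port_pkg: scope re-opened for this part (file-level context, then the namespace/section stack open at the cut)
noncomputable section
open Matrix Complex ComplexConjugate
namespace HodgeCM
namespace PerL34
namespace BallModel
/-- For `s ∈ SU(2)`: `sᴴ = adj(s)`, entrywise, and `det s = 1`. -/
theorem su2_rel {s : Matrix (Fin 2) (Fin 2) ℂ} (hs : s ∈ Matrix.specialUnitaryGroup (Fin 2) ℂ) :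
    conj (s 0 0) = s 1 1 ∧ conj (s 1 0) = -s 0 1 ∧ conj (s 0 1) = -s 1 0 ∧ conj (s 1 1) = s 0 0 ∧
      s 0 0 * s 1 1 - s 0 1 * s 1 0 = 1 := by
  rw [Matrix.mem_specialUnitaryGroup_iff] at hs
  obtain ⟨hu, hd⟩ := hs
  have h1 : star s * s = 1 := Matrix.mem_unitaryGroup_iff'.1 hu
  have h2 : s.adjugate * s = 1 := by rw [Matrix.adjugate_mul, hd, one_smul]
  have e : star s = s.adjugate := (Matrix.inv_eq_left_inv h1).symm.trans (Matrix.inv_eq_left_inv h2)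
  rw [Matrix.adjugate_fin_two] at e
  have e00 := congrFun (congrFun e 0) 0
  have e01 := congrFun (congrFun e 0) 1
  have e10 := congrFun (congrFun e 1) 0
  have e11 := congrFun (congrFun e 1) 1
  simp only [Matrix.star_apply, Complex.star_def, Matrix.of_apply, Matrix.cons_val', Matrix.cons_val_zero,
    Matrix.cons_val_one, Matrix.empty_val', Matrix.cons_val_fin_one] at e00 e01 e10 e11
  rw [Matrix.det_fin_two] at hd
  exact ⟨e00, e01, e10, e11, hd⟩

/-- The stabiliser element `k(s) = blockdiag(s̄, 1)`. -/
def kmat (s : Matrix (Fin 2) (Fin 2) ℂ) : Matrix (Fin 3) (Fin 3) ℂ :=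
  !![conj (s 0 0), conj (s 0 1), 0; conj (s 1 0), conj (s 1 1), 0; 0, 0, 1]

/-- (Ported verbatim from the HodgeCMPerL package; no docstring in the source.) -/
theorem kmat_mem {s : Matrix (Fin 2) (Fin 2) ℂ} (hs : s ∈ Matrix.specialUnitaryGroup (Fin 2) ℂ) :
    (kmat s)ᴴ * J * kmat s = J := by
  obtain ⟨r00, r10, r01, r11, hd⟩ := su2_rel hs
  ext i j
  fin_cases i <;> fin_cases j <;>
    simp [kmat, J, Matrix.mul_apply, Fin.sum_univ_three, conjTranspose_apply, r00, r01, r10, r11,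
      Matrix.diagonal_apply] <;>
    first | linear_combination hd | ring1

/-- `k(s) ∈ U(2,1)`. -/
def kU (s : Matrix (Fin 2) (Fin 2) ℂ) (hs : s ∈ Matrix.specialUnitaryGroup (Fin 2) ℂ) : U21 :=
  mkU21 (kmat s) (kmat_mem hs)

/-- (Ported verbatim from the HodgeCMPerL package; no docstring in the source.) -/
@[simp] theorem mat_kU (s : Matrix (Fin 2) (Fin 2) ℂ) (hs : s ∈ Matrix.specialUnitaryGroup (Fin 2) ℂ) :
    mat (kU s hs) = kmat s := rfl

/-- (Ported verbatim from the HodgeCMPerL package; no docstring in the source.) -/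
theorem kU_smul_x₀ (s : Matrix (Fin 2) (Fin 2) ℂ) (hs : s ∈ Matrix.specialUnitaryGroup (Fin 2) ℂ) :
    kU s hs • x₀ = x₀ := by
  apply Ball.ext; intro i
  rw [smul_val, W3_apply, W3_apply]
  fin_cases i <;> simp [kmat]

/-- (Ported verbatim from the HodgeCMPerL package; no docstring in the source.) -/
theorem coT_kU (s : Matrix (Fin 2) (Fin 2) ℂ) (hs : s ∈ Matrix.specialUnitaryGroup (Fin 2) ℂ) :
    coT (kU s hs) x₀ = s := by
  obtain ⟨r00, r10, r01, r11, hd⟩ := su2_rel hs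
  have hW2 : W3 (kU s hs) x₀ 2 = 1 := by rw [W3_apply]; simp [kmat]
  have hW0 : W3 (kU s hs) x₀ 0 = 0 := by rw [W3_apply]; simp [kmat]
  have hW1 : W3 (kU s hs) x₀ 1 = 0 := by rw [W3_apply]; simp [kmat]
  have hJ : Jac (kU s hs) x₀ = !![s 1 1, -s 1 0; -s 0 1, s 0 0] := by
    ext i j
    fin_cases i <;> fin_cases j <;>
      simp [Jac, hW2, hW0, hW1, kmat, r00, r01, r10, r11]
  have hdet : (Jac (kU s hs) x₀).det = 1 := by
    rw [hJ, Matrix.det_fin_two]; simp; linear_combination hd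
  unfold coT
  rw [hdet, hJ, inv_one, one_smul]
  ext i j
  fin_cases i <;> fin_cases j <;> simp

/-- **Print_isotropy:** every `s ∈ SU(2)` is, in the frame `dz₀, dz₁` of `T^*_{x₀}𝔹²`, the cotangent action of
an element of the stabiliser of `x₀` (with scalar `c = 1`). -/
theorem isotropy_SU2 (s : Matrix (Fin 2) (Fin 2) ℂ) (hs : s ∈ Matrix.specialUnitaryGroup (Fin 2) ℂ) :
    ∃ k : U21, k • x₀ = x₀ ∧ ∃ c : ℂ, c ≠ 0 ∧ ∀ w : Fin 2 → ℂ, A k x₀ w = c • (s *ᵥ w) :=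
  ⟨kU s hs, kU_smul_x₀ s hs, 1, one_ne_zero, fun w => by rw [A_apply, coT_kU, one_smul]⟩

/-! ## Transitivity -/

/-- The boost `B(c,d)` in the `(z₀, ·, 1)`-plane, `c² - d² = 1`. -/
def boostMat (c d : ℝ) : Matrix (Fin 3) (Fin 3) ℂ := !![(c : ℂ), 0, d; 0, 1, 0; d, 0, c]

/-- (Ported verbatim from the HodgeCMPerL package; no docstring in the source.) -/
theorem boostMat_mem (c d : ℝ) (h : c ^ 2 - d ^ 2 = 1) : (boostMat c d)ᴴ * J * boostMat c d = J := by
  have hC : (c : ℂ) ^ 2 - (d : ℂ) ^ 2 = 1 := by exact_mod_cast h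
  ext i j
  fin_cases i <;> fin_cases j <;>
    simp [boostMat, J, Matrix.mul_apply, Fin.sum_univ_three, conjTranspose_apply, Matrix.diagonal_apply] <;>
    first | linear_combination hC | linear_combination -hC | ring1

/-- The rotation `blockdiag(u, 1)`, `u = r⁻¹ (z₀, -z̄₁; z₁, z̄₀) ∈ U(2)` for `|z₀|² + |z₁|² = r²`. -/
def rotMat (z : Fin 2 → ℂ) (r : ℝ) : Matrix (Fin 3) (Fin 3) ℂ :=
  !![z 0 / r, -conj (z 1) / r, 0; z 1 / r, conj (z 0) / r, 0; 0, 0, 1]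

/-- (Ported verbatim from the HodgeCMPerL package; no docstring in the source.) -/
theorem rotMat_mem (z : Fin 2 → ℂ) (r : ℝ) (hr : r ≠ 0)
    (h : conj (z 0) * z 0 + conj (z 1) * z 1 = (r : ℂ) ^ 2) : (rotMat z r)ᴴ * J * rotMat z r = J := by
  have hrC : (r : ℂ) ≠ 0 := by exact_mod_cast hr
  ext i j
  fin_cases i <;> fin_cases j <;>
    simp [rotMat, J, Matrix.mul_apply, Fin.sum_univ_three, conjTranspose_apply, Matrix.diagonal_apply] <;>
    field_simp <;>
    first | linear_combination h | linear_combination -h | ring1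

/-- (Ported verbatim from the HodgeCMPerL package; no docstring in the source.) -/
theorem nsq_pos_of_ne_zero {z : Fin 2 → ℂ} (hz : z ≠ 0) : 0 < nsq z := by
  refine lt_of_le_of_ne (nsq_nonneg z) fun h => hz ?_
  have h0 : ‖z 0‖ ^ 2 = 0 := by unfold nsq at h; nlinarith [sq_nonneg ‖z 0‖, sq_nonneg ‖z 1‖]
  have h1 : ‖z 1‖ ^ 2 = 0 := by unfold nsq at h; nlinarith [sq_nonneg ‖z 0‖, sq_nonneg ‖z 1‖]
  have e0 : z 0 = 0 := by simpa using h0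
  have e1 : z 1 = 0 := by simpa using h1
  funext i
  fin_cases i
  · exact e0
  · exact e1

/-- **Print_transitive (at the base point):** every point of the ball is a translate of `x₀ = 0`. -/
theorem exists_smul_x₀_eq (z : Ball) : ∃ g : U21, g • x₀ = z := by
  by_cases hz : z.1 = 0
  · refine ⟨1, ?_⟩
    rw [one_smul]
    exact Ball.ext fun i => by simp [hz]
  · have hn0 : 0 < nsq z.1 := nsq_pos_of_ne_zero hz
    have hn1 : nsq z.1 < 1 := z.2
    set r : ℝ := Real.sqrt (nsq z.1) with hr_def
    set t : ℝ := Real.sqrt (1 - nsq z.1) with ht_def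
    have hr : 0 < r := Real.sqrt_pos.2 hn0
    have ht : 0 < t := Real.sqrt_pos.2 (by linarith)
    have hr2 : r ^ 2 = nsq z.1 := Real.sq_sqrt hn0.le
    have ht2 : t ^ 2 = 1 - nsq z.1 := Real.sq_sqrt (by linarith)
    have hcd : (1 / t) ^ 2 - (r / t) ^ 2 = 1 := by
      rw [div_pow, div_pow, ← sub_div, one_pow, hr2, ht2]
      exact div_self (by linarith)
    have hzr : conj (z.1 0) * z.1 0 + conj (z.1 1) * z.1 1 = (r : ℂ) ^ 2 := by
      rw [Complex.conj_mul', Complex.conj_mul']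
      have : r ^ 2 = ‖z.1 0‖ ^ 2 + ‖z.1 1‖ ^ 2 := hr2
      exact_mod_cast this.symm
    let B : U21 := mkU21 (boostMat (1 / t) (r / t)) (boostMat_mem _ _ hcd)
    let R : U21 := mkU21 (rotMat z.1 r) (rotMat_mem z.1 r hr.ne' hzr)
    have hrC : (r : ℂ) ≠ 0 := by exact_mod_cast hr.ne'
    have htC : (t : ℂ) ≠ 0 := by exact_mod_cast ht.ne'
    have hB0 : (B • x₀).1 0 = r := by
      rw [smul_val, W3_apply, W3_apply]
      simp [B, boostMat]
      field_simp
    have hB1 : (B • x₀).1 1 = 0 := by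
      rw [smul_val, W3_apply, W3_apply]
      simp [B, boostMat]
    refine ⟨R * B, ?_⟩
    rw [mul_smul]
    apply Ball.ext
    intro i
    rw [smul_val, W3_apply, W3_apply, hB0, hB1]
    fin_cases i
    · simp [R, rotMat]; field_simp
    · simp [R, rotMat]; field_simp

/-- **Print_transitive:** `U(2,1)` acts transitively on `𝔹²`. -/
theorem transitive (x : Ball) : Function.Surjective fun g : U21 => g • x := by
  intro y
  obtain ⟨g, hg⟩ := exists_smul_x₀_eq x
  obtain ⟨h, hh⟩ := exists_smul_x₀_eq y
  refine ⟨h * g⁻¹, ?_⟩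
  show (h * g⁻¹) • x = y
  rw [mul_smul, ← hg, inv_smul_smul, hh]

end BallModel
end PerL34
end HodgeCM

-- port_pkg: scope closed for this part
end
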